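import Literature.ModelTheory.Quasiminimal.ContinuumModel
import Literature.NumberTheory.Transcendental.ZilberFieldQuasiminimal
import HarnessLib

/-!
# The countable closure property of the continuum model

For the continuum model `F = S.F` of `ContinuumModel.lean` (direct limit of the charts `M` along
closed self-embeddings) we show that Kirby's exponential-algebraic closure `ecl` of a finite
subset of `F` is countable, provided `ecl ⊆ cl` in `M` (`cl` the pregeometry of the
quasiminimal structure on `M`; for the Bays–Kirby models `cl = Γcl ⊇ ecl`, B–K Remark 10.10 /
Kirby 2010 *Exponential algebraicity*): a Khovanskii system witnessing `a ∈ ecl^F(X)` has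
finitely many unknowns and coefficients, hence lives in one chart `M`, where it can be pulled
back along the (injective, `exp`-compatible) chart map (`Khovanskii.IsSol.of_map`); so
`ecl^F(X) ⊆ [cl^M(X̃)]`, the image of a countable set (`Setup.ecl_subset_image_cl`,
`Setup.countable_ecl`). This is axiom 5 (CCP) of Bays–Kirby 2018 Thm 8.2 / 9.1 for `F`
("all the axioms are preserved under unions of directed systems of closed embeddings").

## References

* M. Bays, J. Kirby, *Pseudo-exponential maps, variants, and quasiminimality*, Algebra & Number
  Theory 12 (2018), Thm 8.2 (proof), Thm 9.1 (5).
* J. Kirby, *Exponential algebraicity in exponential fields*, Bull. LMS 42 (2010), Def. 3.1–3.2.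
-/

noncomputable section

suppress_compilation

open Set MvPolynomial
open Literature.ModelTheory.ExponentialFields

namespace Literature.NumberTheory.Transcendental.Khovanskii

variable {R T : Type*} [Field R] [Field T] [ExponentialRing R] [ExponentialRing T]

/-- **Pulling a Khovanskii solution back along an E-field embedding**: if `φ x̄` solves the
mapped system `φ f̄` over `φ(C)`, then `x̄` solves `f̄` over `C` (coefficients, equations and the
Jacobian condition are reflected by an injective E-ring morphism). [cite: Kirby2010, Def. 3.1–3.2] -/
theorem IsSol.of_map (φ : ExponentialRingHom R T) {C : Set R} {ι : Type*} [Fintype ι]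
    [DecidableEq ι] {x : ι → R} {f : ι → MvPolynomial (ι ⊕ ι) R}
    (h : IsSol (φ '' C) (φ ∘ x) (fun i => MvPolynomial.map φ.toRingHom (f i))) :
    IsSol C x f where
  coeff i := by
    rw [mem_polyOver_iff]
    intro m
    have hc := mem_polyOver_iff.mp (h.coeff i) m
    rw [coeff_map] at hc
    have hc' : φ.toRingHom ((f i).coeff m) ∈ (Subring.closure C).map φ.toRingHom := by
      rw [RingHom.map_closure]; exact hc
    obtain ⟨c, hc, hcm⟩ := Subring.mem_map.mp hc'
    rwa [← φ.toRingHom.injective hcm]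
  eval_eq i := by
    have := h.eval_eq i
    rw [eval_kpt_map] at this
    exact (map_eq_zero_iff φ.toRingHom φ.toRingHom.injective).1 this
  det_ne := by
    intro hdet
    apply h.det_ne
    rw [kjac_map, ← RingHom.mapMatrix_apply, ← RingHom.map_det, hdet, map_zero]

/-- A Khovanskii solution over `φ(C)` all of whose unknowns lie in the range of `φ` comes from a
solution over `C`: its coordinates lie in `φ(ecl C)`. [cite: Kirby2010, Def. 3.2] -/
theorem mem_image_ecl_of_isSol (φ : ExponentialRingHom R T) {C : Set R} {ι : Type}
    [Fintype ι] [DecidableEq ι] {x : ι → R} {g : ι → MvPolynomial (ι ⊕ ι) T}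
    (h : IsSol (φ '' C) (φ ∘ x) g) (i : ι) : φ (x i) ∈ φ '' ecl C := by
  -- the coefficients of `g` lie in the range of `φ`: lift the system
  have hlift : ∀ k, ∃ f : MvPolynomial (ι ⊕ ι) R, MvPolynomial.map φ.toRingHom f = g k := by
    intro k
    have hk : g k ∈ Set.range (MvPolynomial.map φ.toRingHom) := by
      rw [mem_range_map_iff_coeffs_subset]
      intro c hc
      obtain ⟨m, -, rfl⟩ := mem_coeffs_iff.mp hc
      have := mem_polyOver_iff.mp (h.coeff k) m
      have h' : (g k).coeff m ∈ (Subring.closure C).map φ.toRingHom := by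
        rw [RingHom.map_closure]; exact this
      obtain ⟨c, -, hcm⟩ := Subring.mem_map.mp h'
      exact ⟨c, hcm⟩
    exact hk
  choose f hf using hlift
  have hsol : IsSol (φ '' C) (φ ∘ x) (fun k => MvPolynomial.map φ.toRingHom (f k)) := by
    have : (fun k => MvPolynomial.map φ.toRingHom (f k)) = g := funext hf
    rw [this]; exact h
  exact mem_image_of_mem _ (mem_ecl_iff.mpr ⟨ι, inferInstance, inferInstance, x, f,
    hsol.of_map φ, i, rfl⟩)

end Literature.NumberTheory.Transcendental.Khovanskii

namespace Literature.ModelTheory.Quasiminimal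

namespace Setup

open FirstOrder FirstOrder.Language
open Literature.NumberTheory.Transcendental

variable {L : Language.{0, 0}} {M : Type} [L.Structure M] [Field M] [ExponentialRing M]
  {cl : Set M → Set M} (S : Setup L M cl)

/-- Moving a chart preimage to a bigger chart. [folklore] -/
theorem of_Ψ' {Z W : Finset ℝ} (h : Z ⊆ W) (m : M) : S.of W (S.Ψ Z W m) = S.of Z m := by
  rw [← S.coe_hom h]; exact ExpDirectLimit.of_φ S.hom h m

/-- Every finitely indexed family in `F` comes from one chart. [folklore] -/
theorem exists_chart_family {ι : Type} [Fintype ι] (x : ι → S.F) :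
    ∃ (W : Finset ℝ) (xt : ι → M), S.of W ∘ xt = x := by
  classical
  choose Z m hm using fun i => ExpDirectLimit.exists_of S.hom (x i)
  refine ⟨Finset.univ.sup Z, fun i => S.Ψ (Z i) (Finset.univ.sup Z) (m i), funext fun i => ?_⟩
  rw [Function.comp_apply, S.of_Ψ' (Finset.le_sup (Finset.mem_univ i)), hm]

/-- Images of closed sets under `Ψ` are closed: `Ψ[cl X] = cl (Ψ[X])`. [folklore] -/
theorem image_cl_Ψ' {Z W : Finset ℝ} (h : Z ⊆ W) (X : Set M) :
    S.Ψ Z W '' cl X = cl (S.Ψ Z W '' X) := by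
  have hP := S.isWQPS.isPregeometry
  refine (S.Ψ_isQFEmbOn h).image_cl_eq S.isWQPS (subset_univ _) ?_
  rw [image_univ, ← S.cl_range_Ψ h]
  exact hP.mono (image_subset_range _ _)

/-- **`ecl` in the continuum model is computed in a chart**: for `X̃ ⊆ M` and a chart `Z₀`,
`ecl^F ([X̃]_{Z₀}) ⊆ [cl^M X̃]_{Z₀}` as soon as `ecl ⊆ cl` in `M`.
[cite: BaysKirby2018ANT, Thm 8.2 (proof)] -/
theorem ecl_subset_image_cl (hecl : ∀ A : Set M, ecl A ⊆ cl A) (Z₀ : Finset ℝ) (Xt : Set M) :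
    ecl (S.of Z₀ '' Xt) ⊆ S.of Z₀ '' cl Xt := by
  classical
  intro a ha
  obtain ⟨ι, _, _, x, g, hsol, i, rfl⟩ := Khovanskii.mem_ecl_iff.mp ha
  -- a chart containing the unknowns and `Z₀`
  obtain ⟨W₀, xt₀, hxt₀⟩ := S.exists_chart_family x
  set W := Z₀ ∪ W₀ with hWdef
  have hZ : Z₀ ⊆ W := Finset.subset_union_left
  have hW₀ : W₀ ⊆ W := Finset.subset_union_right
  set xt : ι → M := S.Ψ W₀ W ∘ xt₀ with hxt
  have hx : S.of W ∘ xt = x := by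
    rw [← hxt₀]; exact funext fun k => S.of_Ψ' hW₀ (xt₀ k)
  -- the parameters, read in the chart `W`
  set C : Set M := S.Ψ Z₀ W '' Xt with hC
  have hCim : S.of W '' C = S.of Z₀ '' Xt := by
    rw [hC, image_image]; exact image_congr fun m _ => S.of_Ψ' hZ m
  -- pull the system back to `M`
  let φ : ExponentialRingHom M S.F := ExpDirectLimit.ofExp S.hom W
  have hφ : (φ : M → S.F) = S.of W := rfl
  have hsol' : Khovanskii.IsSol (φ '' C) (φ ∘ xt) g := by rwa [hφ, hCim, hx]
  have hmem := Khovanskii.mem_image_ecl_of_isSol φ hsol' i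
  rw [hφ] at hmem
  obtain ⟨m, hm, hmx⟩ := hmem
  -- `ecl ⊆ cl` in `M`, and `cl` commutes with `Ψ`
  have hm' : m ∈ S.Ψ Z₀ W '' cl Xt := by
    rw [S.image_cl_Ψ' hZ]; exact hecl _ hm
  obtain ⟨m₀, hm₀, rfl⟩ := hm'
  refine ⟨m₀, hm₀, ?_⟩
  rw [← S.of_Ψ' hZ m₀, hmx]
  exact congr_fun hx i

/-- **Countable closure property of the continuum model** (axiom 5 of Bays–Kirby 2018,
Thm 8.2 / 9.1): `ecl^F (X)` is countable for every finite `X ⊆ F`, as soon as `ecl ⊆ cl` in the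
countable quasiminimal chart `M`. [cite: BaysKirby2018ANT, Thm 9.1 (5)] -/
theorem countable_ecl (hecl : ∀ A : Set M, ecl A ⊆ cl A) (X : Set S.F) (hX : X.Finite) :
    (ecl X).Countable := by
  classical
  haveI := S.countable
  -- `X` in one chart
  haveI := hX.fintype
  obtain ⟨Z₀, xt, hxt⟩ := S.exists_chart_family (fun a : X => (a : S.F))
  have hXeq : X = S.of Z₀ '' range xt := by
    ext a
    constructor
    · intro ha
      exact ⟨xt ⟨a, ha⟩, mem_range_self _, congr_fun hxt ⟨a, ha⟩⟩
    · rintro ⟨_, ⟨b, rfl⟩, rfl⟩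
      have := congr_fun hxt b
      simp only [Function.comp_apply] at this
      rw [this]; exact b.2
  rw [hXeq]
  exact ((S.isWQPS.countable_cl _ (finite_range xt)).image (S.of Z₀)).mono
    (S.ecl_subset_image_cl hecl Z₀ (range xt))

end Setup

end Literature.ModelTheory.Quasiminimal

end
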